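import Mathlib
import Literature.NumberTheory.LFunctions.GaussianHeckePrimeSumBookkeeping

/-!
# The Hurwitz zeta value `ζ(0, x) = 1/2 − x` — part 1: Abel summation, the point `e^{2πix}` (`HodgeFermat/HurwitzZero.lean` §§1–2)

Tree copy (part 1 of 2 of §§1–5) of the module `HodgeFermat/HurwitzZero.lean` of the sibling cell's standalone package
`run/shared/lean/pub/pub-hodgefermat/lean/HodgeFermat/` (528 lines, sha256 `93a0e2eafcc9afc5…`), source lines 44–234 (§1 Abel summation bound, §2 the point `e^{2πix}` and the sine partial sums).
Filed by cell `pub-hfermat`, seat prover-1 gen-0, on the COORDINATOR KEEPER RULING of 2026-08-25 (gem sweep H1: take the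
off-gate kernel theorem `thmFstar` — `HodgeFermat/DecodingFinal.lean:29` — through the gate); this file is one link of the
minimal import closure of `thmFstar`.  The source module's declarations are VERBATIM those of the cell record
`check/DecodingFinal_standalone.lean` (27 bodies, 454 223 B, sha256 dca6f17de93119a6…, hub `lean check` rc 0, 130.1 s; pub-hodgefermat `CERT.md` l.978, GATE HF-G32).
Deviations from the source module, exhaustively: the `import` lines (tree modules `Summits.HodgeConjecture.FermatCycles.
HodgeFermat*` instead of `HodgeFermat.*`); this module docstring; ONLY §§1–5 of the source (l.44–497, `import Mathlib` material) are filed — §6 (l.500–528: `hypH0 : HypBReduction.HypH0` and the THEOREM D6 corollaries `hypB_of_U`, `hypW_of_U`, `thmU_of_U`, `theoremD6_of_U`, `theoremD6_of_range_tail`) needs the 17-module analytic D6 chain (`HypBReduction`) and is NOT part of the import closure of `thmFstar`; the `H0` discharge is done in `HodgeFermatThmFstar.lean` by the same one-line term. DEDUP (gate `dedup.landed`): the source's `lemma telescope` (l.54–58) restates the landed `Literature.NumberTheory.LFunctions.GaussianHecke.sum_Ico_sub_succ` and is therefore DELETED, its one use in `abel_bound` (source l.95) now names the Literature lemma (extra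 import `Literature.NumberTheory.LFunctions.GaussianHeckePrimeSumBookkeeping`). One-line docstrings added (gate lint) to `norm_ew`, `ew_pow`, `ew_pow_im`, `norm_ew_pow`, `ew_ne_one`, `norm_ew_sub_one_pos`, `bnd_nonneg`, `geom_bound`, `sin_sum_bound`, `one_sub_ew_mem_slitPlane`, `log_one_sub_ew`, `neg_log_one_sub_ew_im`; the file ends at source l.234 with an `end` line (part 2 = `HodgeFermatHurwitzZeroB.lean`).
Every other line — in particular every declaration's statement and proof — is byte-identical to the source.
HONEST FRAMING: explicit algebraic cycles for specific Hodge classes on Fermat/Delsarte varieties; residual open instances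
listed; no claim on general Hodge.  (This file is arithmetic of CM types; it claims nothing about cycles.)

The source module's docstring (HurwitzZero.lean l.6–42), verbatim:

## The Hurwitz zeta value `ζ(0, x) = 1/2 - x` — `HypH0` discharged; THEOREM D6 from `HypU` alone (HF-G23b)

`HodgeFermat/HypBReduction.lean` (HF-G23) reduces HYPOTHESIS B — and with it THEOREM U and THEOREM D6 of
`tables/KR-FREE.md` / `tables/SEMI-THEOREM.md` §2 — to two residual hypotheses: the classical special value
`HypH0 : ∀ x, 0 < x → x < 1 → hurwitzZeta x 0 = 1/2 - x` of Mathlib's Hurwitz zeta function, and the elementary count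
`HypU` (LEMMA S (b)–(c): `U(N) < 1/6`).  Mathlib v4.32.0 has the values `ζ(-k, x)` only for `k ≠ 0`
(`HurwitzZeta.hurwitzZeta_neg_nat`; the file `Mathlib/NumberTheory/LSeries/HurwitzZetaValues.lean` lists `s = 0` as
omitted "for now" because it needs conditionally convergent Fourier series).  THIS FILE PROVES `HypH0` (theorem `hypH0`),
by exactly that route, inside Mathlib v4.32.0:

1. (§1) Abel's partial-summation inequality `‖Σ_{i ∈ [m,n)} b_i • a_i‖ ≤ 2 B b_m` for bounded partial sums `‖Σ_{i<n} a_i‖ ≤ B`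
   and nonnegative non-increasing real weights `b` (`abel_bound`, from `Finset.sum_Ico_by_parts`).
2. (§2) For `w = e^{2πix}`, `0 < x < 1`: `w ≠ 1`, the geometric partial sums are bounded by `B = 2/‖w - 1‖`, hence so are
   `Σ_{i<n} sin(2πix)` (imaginary parts); `re (1 - w) > 0`; and the explicit polar form
   `1 - w = exp (log (2 sin πx) + i (πx - π/2))`, whence `log (1 - w) = log (2 sin πx) + i (πx - π/2)` (`Complex.log_exp`).
3. (§3) The partial sums `E_M = Σ_{n<M} w^n / n` form a Cauchy sequence (by §1), so converge to some `ℓ`; by ABEL'S LIMIT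
   THEOREM (`Complex.tendsto_tsum_powerSeries_nhdsWithin_lt`) `Σ (w^n/n) r^n → ℓ` as `r ↑ 1`, while for `0 < r < 1` this sum
   is `-log (1 - r w)` (`Complex.hasSum_taylorSeries_neg_log`), which tends to `-log (1 - w)` by continuity of `log` on the
   slit plane (`continuousAt_clog`); so `ℓ = -log (1 - w)` and, taking imaginary parts, `Σ_{n ≥ 1} sin (2πnx)/n = π/2 - πx`.
4. (§4) `sinZeta x 1 = π/2 - πx` (`sinZeta_one`): for real `s > 1` Mathlib gives `sinZeta x s = Σ sin(2πnx) n^{-s}`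
   (`HurwitzZeta.hasSum_nat_sinZeta`); by §1 the tails of these series are bounded by `2B/M` UNIFORMLY in `s ≥ 1`, the partial
   sums are continuous in `s`, and `sinZeta x ·` is continuous (`differentiableAt_sinZeta`); an `ε/4` argument as `s ↓ 1`
   identifies `sinZeta x 1` with the limit of §3.
5. (§5) The functional equation `hurwitzZetaOdd_one_sub` at `s = 1` gives `hurwitzZetaOdd x 0 = sinZeta x 1 / π = 1/2 - x`,
   and `hurwitzZetaEven x 0 = 0` for `x ≠ 0` in `ℝ/ℤ` (`hurwitzZetaEven_apply_zero`); so `hurwitzZeta x 0 = 1/2 - x`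
   (`hurwitzZeta_zero`).
6. (§6) Consequences: `hypH0 : HypH0`, `hypB_of_U : HypU → HypB`, `hypW_of_U`, `thmU_of_U : HypU → ThmU`,
   `theoremD6_of_U : HypU → D6` — THEOREM D6 (no disjoint coincidence of CM types at any squarefree level prime to 6) now rests,
   in the kernel, on the single elementary group-theoretic inequality `HypU` (`U(N) < 1/6`, LEMMA S (b)–(c) of
   `tables/SEMI-THEOREM.md` §2: an explicit finite check per level, verified exactly for `N ≤ 10⁶` there and, in exactly this
   formulation, by `code/gen23/hypU_check2.py` (303 962 levels, maximum `6·U = 9/10` at `N = 55`); analytic tail of LEMMA S (b)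
   beyond).

No `sorry`, no new axioms (`#print axioms theoremD6_of_U`: `propext, Classical.choice, Quot.sound`), no `native_decide`.
Hub check: `check/HurwitzZero_standalone.lean` (GATE HF-G23b).
-/

open Complex Filter Topology Finset HurwitzZeta

namespace HodgeFermat.KRFree.HurwitzZero

/-! ## 1. Abel summation bound -/

section abel

variable {E : Type*} [NormedAddCommGroup E] [NormedSpace ℝ E]

/-- Abel's inequality: if the partial sums of `a` are bounded by `B` and the real weights `b` are
nonnegative and non-increasing from `m` on, then `‖∑_{i ∈ [m, n)} b i • a i‖ ≤ 2 B · b m`. -/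
theorem abel_bound (a : ℕ → E) (b : ℕ → ℝ) (B : ℝ) (hB : ∀ n, ‖∑ i ∈ range n, a i‖ ≤ B)
    {m : ℕ} (hb0 : ∀ i, m ≤ i → 0 ≤ b i) (hba : ∀ i, m ≤ i → b (i + 1) ≤ b i)
    {n : ℕ} (hmn : m ≤ n) : ‖∑ i ∈ Ico m n, b i • a i‖ ≤ 2 * B * b m := by
  have hBnn : 0 ≤ B := le_trans (norm_nonneg _) (hB 0)
  rcases Nat.eq_or_lt_of_le hmn with rfl | hlt
  · simp only [Finset.Ico_self, Finset.sum_empty, norm_zero]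
    have := hb0 m le_rfl
    positivity
  have hm1 : m ≤ n - 1 := Nat.le_sub_one_of_lt hlt
  have hmono : ∀ i j, m ≤ i → i ≤ j → b j ≤ b i := by
    intro i j hi hij
    induction j, hij using Nat.le_induction with
    | base => exact le_rfl
    | succ j hj ih => exact (hba j (hi.trans hj)).trans ih
  rw [Finset.sum_Ico_by_parts b a hlt]
  have h1 : ‖b (n - 1) • ∑ i ∈ range n, a i‖ ≤ b (n - 1) * B := by
    rw [norm_smul, Real.norm_of_nonneg (hb0 _ hm1)]
    exact mul_le_mul_of_nonneg_left (hB n) (hb0 _ hm1)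
  have h2 : ‖b m • ∑ i ∈ range m, a i‖ ≤ b m * B := by
    rw [norm_smul, Real.norm_of_nonneg (hb0 m le_rfl)]
    exact mul_le_mul_of_nonneg_left (hB m) (hb0 m le_rfl)
  have h3 : ‖∑ i ∈ Ico m (n - 1), (b (i + 1) - b i) • ∑ j ∈ range (i + 1), a j‖
      ≤ (b m - b (n - 1)) * B := by
    calc ‖∑ i ∈ Ico m (n - 1), (b (i + 1) - b i) • ∑ j ∈ range (i + 1), a j‖
        ≤ ∑ i ∈ Ico m (n - 1), ‖(b (i + 1) - b i) • ∑ j ∈ range (i + 1), a j‖ :=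
          norm_sum_le _ _
      _ ≤ ∑ i ∈ Ico m (n - 1), (b i - b (i + 1)) * B := by
          refine Finset.sum_le_sum (fun i hi => ?_)
          have hmi : m ≤ i := (Finset.mem_Ico.mp hi).1
          rw [norm_smul, Real.norm_eq_abs, abs_sub_comm,
            abs_of_nonneg (sub_nonneg.mpr (hba i hmi))]
          exact mul_le_mul_of_nonneg_left (hB _) (sub_nonneg.mpr (hba i hmi))
      _ = (b m - b (n - 1)) * B := by
          rw [← Finset.sum_mul, Literature.NumberTheory.LFunctions.GaussianHecke.sum_Ico_sub_succ b hm1]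
  have key : ∀ P Q R : E, ‖P‖ ≤ b (n - 1) * B → ‖Q‖ ≤ b m * B → ‖R‖ ≤ (b m - b (n - 1)) * B →
      ‖P - Q - R‖ ≤ 2 * B * b m := by
    intro P Q R hP hQ hR
    calc ‖P - Q - R‖ ≤ ‖P - Q‖ + ‖R‖ := norm_sub_le _ _
      _ ≤ (‖P‖ + ‖Q‖) + ‖R‖ := by gcongr; exact norm_sub_le _ _
      _ ≤ (b (n - 1) * B + b m * B) + (b m - b (n - 1)) * B := by gcongr
      _ = 2 * B * b m := by ring
  exact key _ _ _ h1 h2 h3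

end abel

/-! ## 2. The point `w = e^{2πix}` on the unit circle and the sine partial sums -/

section circle

variable (x : ℝ)

/-- `ew x = exp (2π i x)`. -/
noncomputable def ew : ℂ := Complex.exp (((2 * Real.pi * x : ℝ) : ℂ) * I)

/-- `‖e^{2πix}‖ = 1` -/
lemma norm_ew : ‖ew x‖ = 1 := Complex.norm_exp_ofReal_mul_I _

/-- `(e^{2πix})^n = e^{2πixn}` -/
lemma ew_pow (n : ℕ) : ew x ^ n = Complex.exp (((2 * Real.pi * x * n : ℝ) : ℂ) * I) := by
  rw [ew, ← Complex.exp_nat_mul]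
  congr 1
  push_cast
  ring

/-- `Im (e^{2πix})^n = sin (2πxn)` -/
lemma ew_pow_im (n : ℕ) : (ew x ^ n).im = Real.sin (2 * Real.pi * x * n) := by
  rw [ew_pow, Complex.exp_ofReal_mul_I_im]

/-- `‖(e^{2πix})^n‖ = 1` -/
lemma norm_ew_pow (n : ℕ) : ‖ew x ^ n‖ = 1 := by
  rw [norm_pow, norm_ew, one_pow]

variable {x}

/-- A real number strictly between `0` and `1` is not an integer. -/
lemma ne_int (hx0 : 0 < x) (hx1 : x < 1) (n : ℤ) : (n : ℝ) ≠ x := by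
  intro h
  have h0 : (0 : ℝ) < n := h ▸ hx0
  have h1 : (n : ℝ) < 1 := h ▸ hx1
  have : (0 : ℤ) < n := by exact_mod_cast h0
  have : (1 : ℝ) ≤ n := by exact_mod_cast this
  linarith

/-- `e^{2πix} ≠ 1` for `0 < x < 1` -/
lemma ew_ne_one (hx0 : 0 < x) (hx1 : x < 1) : ew x ≠ 1 := by
  intro h
  obtain ⟨n, hn⟩ := Complex.exp_eq_one_iff.mp h
  have h2 : ((2 * Real.pi * x : ℝ) : ℂ) = ((n * (2 * Real.pi) : ℝ) : ℂ) := by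
    have h3 : ((2 * Real.pi * x : ℝ) : ℂ) * I = ((n * (2 * Real.pi) : ℝ) : ℂ) * I := by
      rw [hn]; push_cast; ring
    exact mul_right_cancel₀ I_ne_zero h3
  have h4 : 2 * Real.pi * x = n * (2 * Real.pi) := by exact_mod_cast h2
  have h5 : (n : ℝ) = x := by
    have hpi : Real.pi ≠ 0 := Real.pi_ne_zero
    field_simp at h4
    linarith
  exact ne_int hx0 hx1 n h5

/-- `‖e^{2πix} − 1‖ > 0` for `0 < x < 1` -/
lemma norm_ew_sub_one_pos (hx0 : 0 < x) (hx1 : x < 1) : 0 < ‖ew x - 1‖ :=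
  norm_pos_iff.mpr (sub_ne_zero.mpr (ew_ne_one hx0 hx1))

/-- The bound `B = 2 / ‖w - 1‖` for all partial geometric sums. -/
noncomputable def bnd (x : ℝ) : ℝ := 2 / ‖ew x - 1‖

/-- `0 ≤ bnd x` -/
lemma bnd_nonneg : 0 ≤ bnd x := by unfold bnd; positivity

/-- the geometric partial sums `Σ_{i<n} w^i` are bounded by `bnd x` -/
lemma geom_bound (hx0 : 0 < x) (hx1 : x < 1) (n : ℕ) :
    ‖∑ i ∈ range n, ew x ^ i‖ ≤ bnd x := by
  rw [geom_sum_eq (ew_ne_one hx0 hx1), norm_div, bnd]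
  gcongr
  calc ‖ew x ^ n - 1‖ ≤ ‖ew x ^ n‖ + ‖(1 : ℂ)‖ := norm_sub_le _ _
    _ = 2 := by rw [norm_ew_pow, norm_one]; norm_num

/-- the sine partial sums `Σ_{i<n} sin (2πxi)` are bounded by `bnd x` -/
lemma sin_sum_bound (hx0 : 0 < x) (hx1 : x < 1) (n : ℕ) :
    ‖∑ i ∈ range n, ((Real.sin (2 * Real.pi * x * i) : ℝ) : ℂ)‖ ≤ bnd x := by
  rw [← Complex.ofReal_sum, Complex.norm_real, Real.norm_eq_abs]
  have : ∑ i ∈ range n, Real.sin (2 * Real.pi * x * i) = (∑ i ∈ range n, ew x ^ i).im := by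
    rw [Complex.im_sum]
    exact Finset.sum_congr rfl (fun i _ => (ew_pow_im x i).symm)
  rw [this]
  exact (Complex.abs_im_le_norm _).trans (geom_bound hx0 hx1 n)

/-- `re (1 - w) > 0`. -/
lemma one_sub_ew_re_pos (hx0 : 0 < x) (hx1 : x < 1) : 0 < (1 - ew x).re := by
  have hre : (1 - ew x).re = 1 - Real.cos (2 * Real.pi * x) := by
    rw [Complex.sub_re, Complex.one_re, ew, Complex.exp_ofReal_mul_I_re]
  rw [hre, sub_pos, lt_iff_le_and_ne]
  refine ⟨Real.cos_le_one _, fun h => ?_⟩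
  obtain ⟨n, hn⟩ := (Real.cos_eq_one_iff _).mp h
  have : (n : ℝ) = x := by
    have hpi : Real.pi ≠ 0 := Real.pi_ne_zero
    field_simp at hn
    linarith
  exact ne_int hx0 hx1 n this

/-- `1 − e^{2πix}` lies in the slit plane -/
lemma one_sub_ew_mem_slitPlane (hx0 : 0 < x) (hx1 : x < 1) : 1 - ew x ∈ Complex.slitPlane :=
  Complex.mem_slitPlane_iff.mpr (Or.inl (one_sub_ew_re_pos hx0 hx1))

/-- `1 - e^{2πix} = exp (log (2 sin πx) + i (πx - π/2))`. -/
lemma one_sub_ew_eq_exp (hx0 : 0 < x) (hx1 : x < 1) :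
    Complex.exp (((Real.log (2 * Real.sin (Real.pi * x)) : ℝ) : ℂ)
      + ((Real.pi * x - Real.pi / 2 : ℝ) : ℂ) * I) = 1 - ew x := by
  have hsin : 0 < Real.sin (Real.pi * x) := by
    apply Real.sin_pos_of_pos_of_lt_pi
    · positivity
    · nlinarith [Real.pi_pos]
  rw [Complex.exp_add, ← Complex.ofReal_exp, Real.exp_log (by positivity), Complex.exp_mul_I, ew,
    Complex.exp_mul_I]
  have e1 : ((Real.pi * x - Real.pi / 2 : ℝ) : ℂ) = (Real.pi * x : ℝ) - Real.pi / 2 := by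
    push_cast; ring
  have e2 : ((2 * Real.pi * x : ℝ) : ℂ) = 2 * ((Real.pi * x : ℝ) : ℂ) := by push_cast; ring
  rw [e1, Complex.cos_sub_pi_div_two, Complex.sin_sub_pi_div_two, e2]
  have h1 := Complex.cos_two_mul ((Real.pi : ℂ) * (x : ℂ))
  have h2 := Complex.sin_two_mul ((Real.pi : ℂ) * (x : ℂ))
  have h3 := Complex.sin_sq_add_cos_sq ((Real.pi : ℂ) * (x : ℂ))
  push_cast
  linear_combination h1 + I * h2 + 2 * h3

/-- `log (1 − e^{2πix}) = log (2 sin πx) + i(πx − π/2)` -/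
lemma log_one_sub_ew (hx0 : 0 < x) (hx1 : x < 1) :
    Complex.log (1 - ew x) = ((Real.log (2 * Real.sin (Real.pi * x)) : ℝ) : ℂ)
      + ((Real.pi * x - Real.pi / 2 : ℝ) : ℂ) * I := by
  rw [← one_sub_ew_eq_exp hx0 hx1]
  apply Complex.log_exp
  · simp only [Complex.add_im, Complex.ofReal_im, Complex.mul_im, Complex.ofReal_re, Complex.I_re,
      Complex.I_im, mul_zero, mul_one, zero_add, add_zero]
    nlinarith [Real.pi_pos]
  · simp only [Complex.add_im, Complex.ofReal_im, Complex.mul_im, Complex.ofReal_re, Complex.I_re,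
      Complex.I_im, mul_zero, mul_one, zero_add, add_zero]
    nlinarith [Real.pi_pos]

/-- `Im (−log (1 − e^{2πix})) = π/2 − πx` -/
lemma neg_log_one_sub_ew_im (hx0 : 0 < x) (hx1 : x < 1) :
    (-Complex.log (1 - ew x)).im = Real.pi / 2 - Real.pi * x := by
  rw [Complex.neg_im, log_one_sub_ew hx0 hx1]
  simp only [Complex.add_im, Complex.ofReal_im, Complex.mul_im, Complex.ofReal_re, Complex.I_re,
    Complex.I_im, mul_zero, mul_one, zero_add, add_zero]
  ring

end circle

end HodgeFermat.KRFree.HurwitzZero
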